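import Mathlib
import HarnessLib
import Literature.MathematicalPhysics.QuantumLattice.GrassmannDefectSplit
import Summits.HubbardSuperconductivity.HubbardSuperconductivity.Theorems.KLProgrammeKLRegimeTwoVolumeLipDefectDefs
import Summits.HubbardSuperconductivity.HubbardSuperconductivity.Theorems.KLProgrammeKLRegimeTwoVolumeSubstitutionGluingDeepPin

/-!
# Route `KLProgramme` — crux K3 ENGINE (stmt-HubbardSuperconductivity-20437), stub (e) proof-input «(e)-D-ROWS», F-D4c/F-D5c: THE SOURCE TERM OF
# BLOCK `k` THROUGH THE TRANSFER DOOR, AND THE BORN DIFFERENCE AS LIP + SRC AT A PIN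
# (seat hubbard-kl-k3c4-p1 g23; `--supports` 20437; DROWS-SCOPE-g23 §9.2/§9.4 F-D4c, F-D5c)

Block `k` of the two-volume Lipschitz tower (`…TwoVolumeLipDiffDefs.klLipBornDiff`) splits as LIP + SRC (`…LipBlockIdentity.klLipBornDiff_eq_lip_add_src`);
LIP is bounded at a deep pin by `…LipBlockStepDeep.lipBlockStep_deep_le`.  Here the SRC term is put through k3c5-p2's deep-pin TRANSFER DOOR
`…TwoVolumeSubstitutionGluingDeepPin.sum_norm_kernel_map_sub_glue_map_le_of_defect` at the model objects of `…TwoVolumeLipDefectDefs`: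
transfer matrices `T′ = klLipTransfer (bL) …`, `T = klLipTransfer L …` (the periodisation `klLipTransfer_periodise` DISCHARGES the door's `hP`), block
structure `klBlockEquiv` / block embeddings `klBlockEmb` (`klBlockEmb_apply` discharges `hFe₁`, `hFe₂`), fine element
`W′ = effAction (klLipCov (bL)) G − G` (`G = klGlue (klLipInput L …)`), coarse element `W = effAction (klLipCov L) D_L − D_L` whose glued transfer is the
glued coarse born term (`klLipBorn_eq_map_klLipTransfer_born`), and defect `W′ − klGlue W` — exactly the element of
`…LipDefectDefs.lipSourceDefect_eq_defectStep`, bounded at deep pins by `…LipDefectStep.lipSourceDefect_le`.  What stays named: the column / window /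
pin rows and far tails of `T′` (geometry of the sector-analysis transfer matrix, (b) block constants), the coarse born profiles `N`, `N_far`, and the
two defect profiles `E` (near pins), `ND` (global).

* `lipSourceTransfer_le` — the SRC term of block `k` at an output pin: `≤ aⁿ(aE + τ·ND) + (2aⁿτN + n·aⁿ(5τN + 2a·N_far))`.
* `sum_pinned_norm_kernel_klLipBornDiff_le_of_parts` — the born difference of block `k` at a pin is at most (LIP bound) + (SRC bound): the identity
  `klLipBornDiff_eq_lip_add_src`, the transfer form of SRC (`lipSource_eq_transfer_form`, folded into `klLipTransfer` / `klLipCov` / `klLipBorn`),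
  `kernel_add` and the triangle inequality termwise.

Compositions of landed theorems; rows / profiles are hypotheses; nothing asserts the (D) rows, stub (e), VL, K3 or superconductivity.
References: BGM 2006 (2.77)–(2.90), §3 [cite: BenfattoGiulianiMastropietro2006]; Salmhofer 1998 §4.1.
-/

namespace Summit.HubbardSuperconductivity.HubbardSuperconductivity.Theorems.TwoVolumeLip

set_option linter.dupNamespace false -- summit = problem name (single-conjunct summit), D-0017

open Finset Literature.MathematicalPhysics.QuantumLattice GrassmannAlgebra Literature.Probability.LatticeModels
open Literature.MathematicalPhysics.QuantumLattice.FermiRG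
open Summit.HubbardSuperconductivity.HubbardSuperconductivity.Theorems.KLRegimeSplit
open Summit.HubbardSuperconductivity.HubbardSuperconductivity.Theorems.KLProgrammeLegKernels
open Summit.HubbardSuperconductivity.HubbardSuperconductivity.Theorems.DispersionFlow
open Summit.HubbardSuperconductivity.HubbardSuperconductivity.Theorems.EngineV8
open Summit.HubbardSuperconductivity.HubbardSuperconductivity.Theorems.TwoVolumeSource
open Summit.HubbardSuperconductivity.HubbardSuperconductivity.Theorems.TwoVolumeDefect

noncomputable section

variable {L b M : ℕ} [NeZero L] [NeZero (b * L)] [NeZero M]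

/-- **F-D4c — the SRC term of block `k` through the transfer door.**  At an output pin `w′` (leg `p` of a degree-`n+1` kernel on the fine analysed
labels `Γ_{k+1}(bL)`), the source term `map (toLin′ T′) W′ − klGlue (klLipBorn L …)` of block `k` — `T′ = klLipTransfer (bL)`, `W′ = effAction (klLipCov (bL)) G − G`,
`G = klGlue (klLipInput L …)` — is bounded by k3c5-p2's `sum_norm_kernel_map_sub_glue_map_le_of_defect` with the block structure `klBlockEquiv`, the block
embeddings `klBlockEmb` and the coarse transfer `T = klLipTransfer L`; the periodisation `Σ_{res Y″ = Y} T′ X′ Y″ = T (res X′) Y` is DISCHARGED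
(`klLipTransfer_periodise`), and the glued coarse born term is recognised as the glue of `map (toLin′ T) W`, `W = effAction (klLipCov L) D_L − D_L`
(`klLipBorn_eq_map_klLipTransfer_born`).  Named: column / window / pin rows `a` and far tails `τ` of `T′` w.r.t. the zone predicates `Z`, `Near`, `Far`,
`NearF`; the coarse born profiles `N`, `N_far`; the defect profiles `E` (on `NearF` pins) and `ND` of `W′ − klGlue W` (the element of
`lipSourceDefect_eq_defectStep`). -/
theorem lipSourceTransfer_le {β : ℝ} (hβ : β ≠ 0) (U μ : ℝ) (K : TrigPolyC4v) {d k : ℕ} (hdk : 1 ≤ d * k)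
    (hZc : hubbardEffPartitionFnCT L M β U μ 0 K (klScale klE0 (d * k)) ≠ 0)
    {n : ℕ} (p : Fin (n + 1)) (w' : SpaceTimeIdx (b * L) M × SectorLeg (sectorCount (d * k)))
    (Z Near : SpaceTimeIdx L M × SectorLeg (sectorCount (d * k - 1)) → Prop) [DecidablePred Z] [DecidablePred Near]
    (Far : SpaceTimeIdx L M × SectorLeg (sectorCount (d * k - 1)) → SpaceTimeIdx L M × SectorLeg (sectorCount (d * k - 1)) → Prop)
    [DecidableRel Far] (hZ : ∀ y y', Near y → Z y' → Far y y')
    (NearF : SpaceTimeIdx (b * L) M × SectorLeg (sectorCount (d * k - 1)) → Prop) [DecidablePred NearF]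
    {a τ N Nfar E ND : ℝ} (ha : 0 ≤ a) (hτ0 : 0 ≤ τ) (hN0 : 0 ≤ N) (hNfar0 : 0 ≤ Nfar) (hE0 : 0 ≤ E) (hND0 : 0 ≤ ND)
    (hcol : ∀ y', ∑ x, ‖klLipTransfer (b * L) M β μ K d k x y'‖ ≤ a)
    (hwin : ∀ (B' : Fin 2 → Fin b) (y : SpaceTimeIdx L M × SectorLeg (sectorCount (d * k - 1))),
      ∑ B : Fin 2 → Fin b, ∑ x ∈ univ.filter (fun x : SpaceTimeIdx (b * L) M × SectorLeg (sectorCount (d * k)) =>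
          (klBlockEquiv L b M (sectorCount (d * k)) x).1 = B'),
        ‖klLipTransfer (b * L) M β μ K d k x ((klBlockEquiv L b M (sectorCount (d * k - 1))).symm (B, y))‖ ≤ a)
    (hρ : ∑ y, ‖klLipTransfer (b * L) M β μ K d k w'
        ((klBlockEquiv L b M (sectorCount (d * k - 1))).symm ((klBlockEquiv L b M (sectorCount (d * k)) w').1, y))‖ ≤ a)
    (hrowF : ∑ y' ∈ univ.filter (fun y' : SpaceTimeIdx (b * L) M × SectorLeg (sectorCount (d * k - 1)) => NearF y'),
      ‖klLipTransfer (b * L) M β μ K d k w' y'‖ ≤ a)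
    (hτF : ∑ y' ∈ univ.filter (fun y' : SpaceTimeIdx (b * L) M × SectorLeg (sectorCount (d * k - 1)) => ¬ NearF y'),
      ‖klLipTransfer (b * L) M β μ K d k w' y'‖ ≤ τ)
    (hτ₁ : ∀ y, ¬ Z y → ∑ x ∈ univ.filter (fun x : SpaceTimeIdx (b * L) M × SectorLeg (sectorCount (d * k)) =>
        (klBlockEquiv L b M (sectorCount (d * k)) x).1 ≠ (klBlockEquiv L b M (sectorCount (d * k)) w').1),
      ‖klLipTransfer (b * L) M β μ K d k x
        ((klBlockEquiv L b M (sectorCount (d * k - 1))).symm ((klBlockEquiv L b M (sectorCount (d * k)) w').1, y))‖ ≤ τ)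
    (hτ₂ : ∑ B ∈ univ.erase (klBlockEquiv L b M (sectorCount (d * k)) w').1, ∑ y,
      ‖klLipTransfer (b * L) M β μ K d k w' ((klBlockEquiv L b M (sectorCount (d * k - 1))).symm (B, y))‖ ≤ τ)
    (hτ₃ : ∑ y ∈ univ.filter (fun y : SpaceTimeIdx L M × SectorLeg (sectorCount (d * k - 1)) => ¬ Near y),
      ‖klLipTransfer (b * L) M β μ K d k w'
        ((klBlockEquiv L b M (sectorCount (d * k - 1))).symm ((klBlockEquiv L b M (sectorCount (d * k)) w').1, y))‖ ≤ τ)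
    (hτ₄ : ∀ y, ¬ Z y → ∑ B ∈ univ.erase (klBlockEquiv L b M (sectorCount (d * k)) w').1,
      ∑ x ∈ univ.filter (fun x : SpaceTimeIdx (b * L) M × SectorLeg (sectorCount (d * k)) =>
          (klBlockEquiv L b M (sectorCount (d * k)) x).1 = (klBlockEquiv L b M (sectorCount (d * k)) w').1),
        ‖klLipTransfer (b * L) M β μ K d k x ((klBlockEquiv L b M (sectorCount (d * k - 1))).symm (B, y))‖ ≤ τ)
    (hN : ∀ y, ∑ Y ∈ univ.filter (fun Y : Fin (n + 1) → SpaceTimeIdx L M × SectorLeg (sectorCount (d * k - 1)) => Y p = y),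
      ‖kernel ℂ (effAction ℂ (klLipCov L M β μ K d k) (klLipInput L M β U μ K d k) - klLipInput L M β U μ K d k) (n + 1) Y‖ ≤ N)
    (hNfar : ∀ y (i : Fin (n + 1)),
      ∑ Y ∈ univ.filter (fun Y : Fin (n + 1) → SpaceTimeIdx L M × SectorLeg (sectorCount (d * k - 1)) => Y p = y ∧ Far (Y p) (Y i)),
        ‖kernel ℂ (effAction ℂ (klLipCov L M β μ K d k) (klLipInput L M β U μ K d k) - klLipInput L M β U μ K d k) (n + 1) Y‖ ≤ Nfar)
    (hE : ∀ y', NearF y' →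
      ∑ Y' ∈ univ.filter (fun Y' : Fin (n + 1) → SpaceTimeIdx (b * L) M × SectorLeg (sectorCount (d * k - 1)) => Y' p = y'),
        ‖kernel ℂ ((effAction ℂ (klLipCov (b * L) M β μ K d k) (klGlue L b M (sectorCount (d * k - 1)) (klLipInput L M β U μ K d k)) -
              klGlue L b M (sectorCount (d * k - 1)) (klLipInput L M β U μ K d k)) -
            klGlue L b M (sectorCount (d * k - 1))
              (effAction ℂ (klLipCov L M β μ K d k) (klLipInput L M β U μ K d k) - klLipInput L M β U μ K d k)) (n + 1) Y'‖ ≤ E)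
    (hND : ∀ y',
      ∑ Y' ∈ univ.filter (fun Y' : Fin (n + 1) → SpaceTimeIdx (b * L) M × SectorLeg (sectorCount (d * k - 1)) => Y' p = y'),
        ‖kernel ℂ ((effAction ℂ (klLipCov (b * L) M β μ K d k) (klGlue L b M (sectorCount (d * k - 1)) (klLipInput L M β U μ K d k)) -
              klGlue L b M (sectorCount (d * k - 1)) (klLipInput L M β U μ K d k)) -
            klGlue L b M (sectorCount (d * k - 1))
              (effAction ℂ (klLipCov L M β μ K d k) (klLipInput L M β U μ K d k) - klLipInput L M β U μ K d k)) (n + 1) Y'‖ ≤ ND) :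
    ∑ X' ∈ univ.filter (fun X' : Fin (n + 1) → SpaceTimeIdx (b * L) M × SectorLeg (sectorCount (d * k)) => X' p = w'),
        ‖kernel ℂ (ExteriorAlgebra.map (Matrix.toLin' (klLipTransfer (b * L) M β μ K d k))
              (effAction ℂ (klLipCov (b * L) M β μ K d k) (klGlue L b M (sectorCount (d * k - 1)) (klLipInput L M β U μ K d k)) -
                klGlue L b M (sectorCount (d * k - 1)) (klLipInput L M β U μ K d k)) -
            klGlue L b M (sectorCount (d * k)) (klLipBorn L M β U μ K d k)) (n + 1) X'‖ ≤
      a ^ n * (a * E + τ * ND) + (2 * a ^ n * τ * N + n * a ^ n * (5 * τ * N + 2 * a * Nfar)) := by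
  rw [klLipBorn_eq_map_klLipTransfer_born (V := L) hβ U μ K hdk hZc]
  have hmain := sum_norm_kernel_map_sub_glue_map_le_of_defect (𝕜 := ℂ)
    (klBlockEquiv L b M (sectorCount (d * k - 1))) (klBlockEquiv L b M (sectorCount (d * k)))
    (klLipTransfer L M β μ K d k) (klLipTransfer (b * L) M β μ K d k) (fun X' Y => klLipTransfer_periodise hβ μ K d k X' Y)
    (klBlockEmb L b M (sectorCount (d * k - 1))) (fun B v X' => klBlockEmb_apply B v X')
    (klBlockEmb L b M (sectorCount (d * k))) (fun B v X' => klBlockEmb_apply B v X')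
    (effAction ℂ (klLipCov (b * L) M β μ K d k) (klGlue L b M (sectorCount (d * k - 1)) (klLipInput L M β U μ K d k)) -
      klGlue L b M (sectorCount (d * k - 1)) (klLipInput L M β U μ K d k))
    (effAction ℂ (klLipCov L M β μ K d k) (klLipInput L M β U μ K d k) - klLipInput L M β U μ K d k) p w' Z Near Far hZ NearF
    ha hτ0 hN0 hNfar0 hE0 hND0 hcol hwin hρ hrowF hτF hτ₁ hτ₂ hτ₃ hτ₄ hN hNfar hE hND
  refine Eq.trans_le (Finset.sum_congr rfl fun X' _ => ?_) hmain
  rw [kernel_sub']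
  rfl

/-- **F-D5c (pin level) — the born difference of block `k` as LIP + SRC.**  At any pin, the pinned kernel sum of `klLipBornDiff L b M β U μ K d k` is at
most a bound `B₁` of the LIP term (the first summand of `klLipBornDiff_eq_lip_add_src`; at a deep pin `…LipBlockStepDeep.lipBlockStep_deep_le`) plus a
bound `B₂` of the SRC term in transfer form (`lipSourceTransfer_le`): the identity, `lipSource_eq_transfer_form` folded into `klLipTransfer` / `klLipCov` /
`klLipBorn` (`klLipTransfer_def`, `klLipCov_def`, `klLipBorn_eq_map_klLipTransfer_born`), `kernel_add` and the triangle inequality termwise. -/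
theorem sum_pinned_norm_kernel_klLipBornDiff_le_of_parts {β : ℝ} (hβ : β ≠ 0) (U μ : ℝ) (K : TrigPolyC4v) {d k : ℕ} (hdk : 1 ≤ d * k)
    (hZ : hubbardEffPartitionFnCT (b * L) M β U μ 0 K (klScale klE0 (d * k)) ≠ 0)
    (hZc : hubbardEffPartitionFnCT L M β U μ 0 K (klScale klE0 (d * k)) ≠ 0)
    {m : ℕ} (i : Fin m) (w'' : SpaceTimeIdx (b * L) M × SectorLeg (sectorCount (d * k))) {B₁ B₂ : ℝ}
    (h₁ : ∑ X'' ∈ univ.filter (fun X'' : Fin m → SpaceTimeIdx (b * L) M × SectorLeg (sectorCount (d * k)) => X'' i = w''),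
      ‖kernel ℂ
          (ExteriorAlgebra.map (Matrix.toLin' ((((imagTimeWeight β M : ℝ) : ℂ)) •
              sectorAnalysisMatrix (b * L) M β (klAnisoFamily (b * L) M β μ K klE0 (d * k))))
            ((effAction ℂ (hubbardCovSliceCT (b * L) M β μ 0 K (klScale klE0 (d * (k + 1))) (klScale klE0 (d * k)))
                  (ExteriorAlgebra.map (Matrix.toLin' (sectorSubMatrix (b * L) M β
                      (bgmFatMultiplier (b * L) M klE0 β (nambuXiCT (b * L) μ K) (d * k - 1))))
                    (klGlue L b M (sectorCount (d * k - 1)) (klLipInput L M β U μ K d k) + klLipInputDiff L b M β U μ K d k)) -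
                ExteriorAlgebra.map (Matrix.toLin' (sectorSubMatrix (b * L) M β
                    (bgmFatMultiplier (b * L) M klE0 β (nambuXiCT (b * L) μ K) (d * k - 1))))
                  (klGlue L b M (sectorCount (d * k - 1)) (klLipInput L M β U μ K d k) + klLipInputDiff L b M β U μ K d k)) -
              (effAction ℂ (hubbardCovSliceCT (b * L) M β μ 0 K (klScale klE0 (d * (k + 1))) (klScale klE0 (d * k)))
                  (ExteriorAlgebra.map (Matrix.toLin' (sectorSubMatrix (b * L) M β
                      (bgmFatMultiplier (b * L) M klE0 β (nambuXiCT (b * L) μ K) (d * k - 1))))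
                    (klGlue L b M (sectorCount (d * k - 1)) (klLipInput L M β U μ K d k))) -
                ExteriorAlgebra.map (Matrix.toLin' (sectorSubMatrix (b * L) M β
                    (bgmFatMultiplier (b * L) M klE0 β (nambuXiCT (b * L) μ K) (d * k - 1))))
                  (klGlue L b M (sectorCount (d * k - 1)) (klLipInput L M β U μ K d k))))) m X''‖ ≤ B₁)
    (h₂ : ∑ X'' ∈ univ.filter (fun X'' : Fin m → SpaceTimeIdx (b * L) M × SectorLeg (sectorCount (d * k)) => X'' i = w''),
      ‖kernel ℂ (ExteriorAlgebra.map (Matrix.toLin' (klLipTransfer (b * L) M β μ K d k))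
            (effAction ℂ (klLipCov (b * L) M β μ K d k) (klGlue L b M (sectorCount (d * k - 1)) (klLipInput L M β U μ K d k)) -
              klGlue L b M (sectorCount (d * k - 1)) (klLipInput L M β U μ K d k)) -
          klGlue L b M (sectorCount (d * k)) (klLipBorn L M β U μ K d k)) m X''‖ ≤ B₂) :
    ∑ X'' ∈ univ.filter (fun X'' : Fin m → SpaceTimeIdx (b * L) M × SectorLeg (sectorCount (d * k)) => X'' i = w''),
        ‖kernel ℂ (klLipBornDiff L b M β U μ K d k) m X''‖ ≤ B₁ + B₂ := by
  rw [klLipBornDiff_eq_lip_add_src hβ U μ K hdk hZ, lipSource_eq_transfer_form hβ U μ K hdk hZc, ← klLipTransfer_def, ← klLipCov_def,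
    ← klLipTransfer_def, ← klLipCov_def, ← klLipBorn_eq_map_klLipTransfer_born (V := L) hβ U μ K hdk hZc]
  refine le_trans (Finset.sum_le_sum fun X'' _ => ?_) (le_of_eq_of_le Finset.sum_add_distrib (add_le_add h₁ h₂))
  rw [kernel_add]
  exact norm_add_le _ _

end

end Summit.HubbardSuperconductivity.HubbardSuperconductivity.Theorems.TwoVolumeLip
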